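import Summits.QuantumAdvantage.QuantumAdvantage.Theorems.SosSandwichPseudoBoundedAAClassicalCornerSpectralDuality
import Summits.QuantumAdvantage.QuantumAdvantage.Theorems.SosSandwichPseudoBoundedAAClassicalCornerSensitivityOSSS
import HarnessLib

/-!
# Crux `PseudoBoundedAA` (stmt-QuantumAdvantage-15237, route SosSandwich) — classical corner: the spectral constant of a
# tree is at most a quarter of its total influence, `Φ(t) ≤ ¼·I[F]`, and this is attained up to constants

Support file (`--supports stmt-QuantumAdvantage-15237`), sequel of `…ClassicalCornerSpectralDuality.lean`.
`Φ(t) = Σ_{S≠∅} F̂(S)²/δ_t(S)` is the exact per-tree constant of the bilinear route (`four_cov_sq_le_phi_mul`,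
`sixteen_var_sq_le_four_phiMax_mul`: `C₀ ≤ 4·max Φ`); `not_exists_bilinear_osss` shows `sup_t Φ(t) = ∞` via the recursive
binary address tree `T_h` (`Φ(T_h) ≥ h²/(4(3h−4+4·2^{−h})) ≈ h/12`).  Here the matching UPPER bound:

* `cubeFourierCoeff_walshExpansion` — the coefficients of `x ↦ Σ_S c_S χ_S(x)` are the `c_S`;
* **`phi_le_quarter_totalInfluence`** — for every decision tree `t` with `0/1` output `F`:
  `Σ_{S≠∅} F̂(S)²/δ_t(S) ≤ ¼·Σⱼ Infⱼ[F]` (`Infⱼ[F] = E(F(x^{j→1}) − F(x^{j→0}))²`, total influence `I[F] ≤ depth`).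
  Proof: take the dual witness `g* = Σ_S (F̂(S)/δ_t(S)) χ_S`, for which `Cov[F,g*] = Φ` and `Σⱼδⱼ Infⱼ[g*] = 4Φ`, and
  apply the bilinear OSSS inequality `osss_sens` (`16·Cov² ≤ I[F]·Σⱼ δⱼ Infⱼ[g]`).

Reading.  `Φ(t) ∈ [0, ¼ I[F]]`, the per-tree route gives at best `C₀ ≤ Ī`-type laws (the hands' `C₀ = Ī`), and for
`T_h` (`I = (h+1)/2`) the two sides agree up to a constant: `h/12 ≲ Φ(T_h) ≤ (h+1)/8`.  So the harmonic-mean defect of OSSS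
is governed by the total influence and by nothing smaller.

Honest label: calibration inside the classical corner of an open conjecture; no stub, crux or summit is closed.
Sources: R. O'Donnell, *Analysis of Boolean Functions* (2014) §1.4, §3.4, §8.6; O'Donnell–Saks–Schramm–Servedio,
FOCS 2005, Thm 3.2; H. Lee, ToC 6 (2010).
-/

set_option linter.dupNamespace false

noncomputable section

namespace Summit.QuantumAdvantage.QuantumAdvantage.Theorems.SosSandwich

open Finset Function
open Literature.Computability.Complexity
open Literature.Probability.RandomGraphs.LowDegree (walsh sgn)
open Literature.Computability.Complexity.LowDegree (cubeFourierCoeff)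

namespace ClassicalCornerSpectralDuality

variable {N : ℕ}

/-- The Fourier coefficients of a Walsh expansion `x ↦ Σ_S c_S χ_S(x)` are its coefficients. [cite: ODonnell2014, §1.4] -/
theorem cubeFourierCoeff_walshExpansion (c : Finset (Fin N) → ℝ) (T : Finset (Fin N)) :
    cubeFourierCoeff (fun x => ∑ S, c S * walsh S x) T = c T := by
  classical
  rw [LowDegree.cubeFourierCoeff_sum]
  have h : ∀ S : Finset (Fin N), cubeFourierCoeff (fun x => c S * walsh S x) T = if S = T then c S else 0 := by
    intro S
    rw [LowDegree.cubeFourierCoeff_const_mul, LowDegree.cubeFourierCoeff_walsh]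
    split_ifs <;> simp
  rw [Finset.sum_congr rfl fun S _ => h S, Finset.sum_ite_eq' Finset.univ T]
  simp

/-- **`Φ(t) ≤ ¼·I[F]`.**  For every decision tree `t` with `0/1` output `F`, the spectral constant
`Σ_{S≠∅} F̂(S)²/δ_t(S)` is at most a quarter of the total influence `Σⱼ E(F(x^{j→1}) − F(x^{j→0}))²` — the dual witness
`g* = Σ_S (F̂(S)/δ_t(S))χ_S` fed into the bilinear OSSS inequality. [cite: ODonnell2014, §8.6] [cite: OdonnellEtAl2005, Thm 3.2] -/
theorem phi_le_quarter_totalInfluence (t : DecisionTree N) (F : (Fin N → Bool) → ℝ)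
    (hF : ∀ x, F x = if t.eval x = true then (1 : ℝ) else 0) :
    ∑ S ∈ Finset.univ.filter (fun S : Finset (Fin N) => S.Nonempty), cubeFourierCoeff F S ^ 2 /
        ∑ j ∈ S, ((Finset.univ.filter fun x : Fin N → Bool => j ∈ t.queries x).card : ℝ) / (2 : ℝ) ^ N ≤
      (∑ j, (∑ x, (F (update x j true) - F (update x j false)) ^ 2) / (2 : ℝ) ^ N) / 4 := by
  classical
  -- opaque abbreviations: `δ j`, `Φ`, `Iun`
  obtain ⟨δ, hδ⟩ : ∃ δ : Fin N → ℝ, ∀ j,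
      δ j = ((Finset.univ.filter fun x : Fin N → Bool => j ∈ t.queries x).card : ℝ) / (2 : ℝ) ^ N :=
    ⟨_, fun _ => rfl⟩
  simp only [← hδ]
  obtain ⟨Φ, hΦ⟩ : ∃ Φ : ℝ, Φ = ∑ S ∈ Finset.univ.filter (fun S : Finset (Fin N) => S.Nonempty),
      cubeFourierCoeff F S ^ 2 / ∑ j ∈ S, δ j := ⟨_, rfl⟩
  obtain ⟨Iun, hIun⟩ : ∃ I : ℝ, I = ∑ j, ∑ x, (F (update x j true) - F (update x j false)) ^ 2 := ⟨_, rfl⟩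
  have h2N : (0 : ℝ) < (2 : ℝ) ^ N := by positivity
  have h4N : (0 : ℝ) < (4 : ℝ) ^ N := by positivity
  have h4 : (4 : ℝ) ^ N = (2 : ℝ) ^ N * (2 : ℝ) ^ N := by rw [← mul_pow]; norm_num
  have hδ0 : ∀ j, 0 ≤ δ j := fun j => by rw [hδ]; positivity
  have hΦ0 : 0 ≤ Φ := by
    rw [hΦ]; exact Finset.sum_nonneg fun S _ => div_nonneg (sq_nonneg _) (Finset.sum_nonneg fun j _ => hδ0 j)
  have hIun0 : 0 ≤ Iun := by
    rw [hIun]; exact Finset.sum_nonneg fun j _ => Finset.sum_nonneg fun x _ => sq_nonneg _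
  have hI : (∑ j, (∑ x, (F (update x j true) - F (update x j false)) ^ 2) / (2 : ℝ) ^ N) = Iun / (2 : ℝ) ^ N := by
    rw [hIun, Finset.sum_div]
  rw [← hΦ, hI]
  -- the dual witness `g = Σ_S (F̂(S)/δ(S)) χ_S`
  obtain ⟨c, hc⟩ : ∃ c : Finset (Fin N) → ℝ, ∀ S, c S = cubeFourierCoeff F S / ∑ j ∈ S, δ j := ⟨_, fun _ => rfl⟩
  obtain ⟨g, hg⟩ : ∃ g : (Fin N → Bool) → ℝ, ∀ x, g x = ∑ S, c S * walsh S x := ⟨_, fun _ => rfl⟩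
  have hĝ : ∀ S, cubeFourierCoeff g S = c S := by
    have : g = fun x => ∑ S, c S * walsh S x := funext hg
    rw [this]; exact cubeFourierCoeff_walshExpansion c
  -- `Cov[F, g] = Φ`
  have hcov : (∑ x, F x * g x) / (2 : ℝ) ^ N - ((∑ x, F x) / (2 : ℝ) ^ N) * ((∑ x, g x) / (2 : ℝ) ^ N) = Φ := by
    rw [← covFourier_eq, hΦ]
    refine Finset.sum_congr rfl fun S _ => ?_
    rw [hĝ, hc]
    ring
  -- `Σ_S ĝ² δ(S) = Φ`, hence `Σ_j δ_j Inf_j[g] = 4 Φ`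
  have hall : ∑ S : Finset (Fin N), c S ^ 2 * ∑ j ∈ S, δ j = Φ := by
    have hterm : ∀ S : Finset (Fin N), c S ^ 2 * ∑ j ∈ S, δ j = cubeFourierCoeff F S ^ 2 / ∑ j ∈ S, δ j := by
      intro S
      rw [hc]
      by_cases h0 : ∑ j ∈ S, δ j = 0
      · rw [h0]; simp
      · field_simp
    rw [Finset.sum_congr rfl fun S _ => hterm S, hΦ,
      ← Finset.sum_filter_add_sum_filter_not Finset.univ (fun S : Finset (Fin N) => S.Nonempty)]
    have hempty : ∑ S ∈ Finset.univ.filter (fun S : Finset (Fin N) => ¬ S.Nonempty),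
        cubeFourierCoeff F S ^ 2 / ∑ j ∈ S, δ j = 0 := by
      refine Finset.sum_eq_zero fun S hS => ?_
      rw [Finset.mem_filter, Finset.not_nonempty_iff_eq_empty] at hS
      rw [hS.2, Finset.sum_empty, div_zero]
    rw [hempty, add_zero]
  have hB : ∑ j, δ j * ((∑ x, (g (update x j true) - g (update x j false)) ^ 2) / (2 : ℝ) ^ N) = 4 * Φ := by
    have hw := ClassicalCornerSpectralL1.sum_sq_mul_weight_eq g δ
    simp only [hĝ] at hw
    rw [hall] at hw
    linarith
  -- un-normalised forms for `osss_sens`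
  obtain ⟨Sg, hSg⟩ : ∃ Sg : Fin N → ℝ, ∀ j, Sg j = ∑ x, (g (update x j true) - g (update x j false)) ^ 2 :=
    ⟨_, fun _ => rfl⟩
  have hSg0 : ∀ j, 0 ≤ Sg j := fun j => by rw [hSg]; exact Finset.sum_nonneg fun x _ => sq_nonneg _
  have hcovun : (2 : ℝ) ^ N * (∑ x, F x * g x) - (∑ x, F x) * (∑ x, g x) = (4 : ℝ) ^ N * Φ := by
    rw [h4, ← hcov]
    field_simp
  have hWS : ∑ j, ((Finset.univ.filter fun x : Fin N → Bool => j ∈ t.queries x).card : ℝ) * Sg j =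
      (4 : ℝ) ^ N * (4 * Φ) := by
    rw [← hB, Finset.mul_sum]
    refine Finset.sum_congr rfl fun j _ => ?_
    rw [h4, hδ, hSg]
    field_simp
  have hosss : ∀ lam : ℝ, 0 < lam →
      (4 : ℝ) ^ N * Φ ≤ (lam * ((2 : ℝ) ^ N * Iun) + ((4 : ℝ) ^ N * (4 * Φ)) / lam) / 8 := by
    intro lam hl
    have h := ClassicalCornerSensitivityOSSS.osss_sens t F g Sg hF hSg0 hl (fun j => (hSg j).symm.le)
    rw [hcovun, hWS, ← hIun] at h
    refine h.trans (le_of_eq ?_)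
    ring
  have h16 := ClassicalCornerSensitivityOSSS.sixteen_sq_le_of_forall_pos (mul_nonneg h4N.le hΦ0)
    (mul_nonneg h2N.le hIun0) (by positivity) hosss
  -- `16 (4^N Φ)² ≤ 2^N Iun · 4^N · 4Φ`, i.e. `Φ ≤ Iun/(4·2^N)`
  by_cases hΦz : Φ = 0
  · rw [hΦz]; exact div_nonneg (div_nonneg hIun0 h2N.le) (by norm_num)
  · have hΦp : 0 < Φ := lt_of_le_of_ne hΦ0 (Ne.symm hΦz)
    have hpos : 0 < 4 * (4 : ℝ) ^ N * Φ := by positivity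
    have hprod : (4 * (4 : ℝ) ^ N * Φ) * (4 * (4 : ℝ) ^ N * Φ) ≤ ((2 : ℝ) ^ N * Iun) * (4 * (4 : ℝ) ^ N * Φ) := by
      have e1 : (4 * (4 : ℝ) ^ N * Φ) * (4 * (4 : ℝ) ^ N * Φ) = 16 * ((4 : ℝ) ^ N * Φ) ^ 2 := by ring
      have e2 : ((2 : ℝ) ^ N * Iun) * (4 * (4 : ℝ) ^ N * Φ) = (2 : ℝ) ^ N * Iun * ((4 : ℝ) ^ N * (4 * Φ)) := by ring
      rw [e1, e2]; exact h16
    have hlin : 4 * (4 : ℝ) ^ N * Φ ≤ (2 : ℝ) ^ N * Iun := le_of_mul_le_mul_right hprod hpos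
    rw [le_div_iff₀ (by norm_num : (0 : ℝ) < 4), le_div_iff₀ h2N]
    rw [h4] at hlin
    have : (Φ * 4 * (2 : ℝ) ^ N) * (2 : ℝ) ^ N ≤ Iun * (2 : ℝ) ^ N := by nlinarith
    exact le_of_mul_le_mul_right this h2N

end ClassicalCornerSpectralDuality

end Summit.QuantumAdvantage.QuantumAdvantage.Theorems.SosSandwich

end
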